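/-
Copyright (c) 2026 the pub-hodgecm-mathlib formalisation cell (harness21).  Typer∕survey seat hodgecm-mathlib-typ-T5b (g0), topic T5 = P8
«(C♯)hol interior», 2026-08-31.  KERNEL module: THEOREMS ONLY (no definition, no named fact, no instance, no notation, no `sorry`).
-/
import Literature.NumberTheory.Automorphic.Liu2021.Def411ChiAutomorphicQuotient
import Literature.NumberTheory.Automorphic.Liu2021.FinAdelicCheckDescent
import Literature.NumberTheory.Automorphic.UnitaryGroupAdelicCenterRational
import Literature.NumberTheory.Automorphic.UnitaryGroupArchDet
import Literature.NumberTheory.Automorphic.UnitaryGroupAdelicLineTorus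
import HarnessLib

/-!
# [Liu2021, Def. 4.11] the DESCENT: a character of `[U(W)]` trivial at the archimedean places IS `chiQuot χ` for a `χ ∈ Chi`

Topic `NumberTheory/Automorphic/Liu2021`; namespace `Literature.NumberTheory.Automorphic.Liu2021.Def411WeilCarriers`.  THEOREMS ONLY.
The converse of ★ `Def411ChiAutomorphicQuotient` (`χ : Chi F E c ↦ chiQuot … a χ : PontryaginDual [U(J_W a)]`, finite part `χ_W`,
trivial archimedean part): **every continuous unitary character `χ̃` of `[U(J_W a)] = U(J_W a)(𝔸_F) ⧸ U(J_W a)(F)` which is trivial on the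
archimedean factor `(x_∞, 1)` is `chiQuot a χ` for a (unique) `χ ∈ Chi F E c`** — Liu's index set `E¹\(𝔸_E^∞)¹` of [Liu2021, Def. 4.11
third bullet] is exactly the set of automorphic characters of `[U(W)]` with `χ_∞ = 1`.  Cell hodgecm-mathlib FLOOR 0, programme P2, topic
T5 = P8: the descent step of node B of the (C♯)hol interior (after ★ `Liu2021/ThetaLiftFromLineCentralCharacter` §5: the theta character of a
holomorphic-cotangent `P` has `χ_∞ = 1`).

THE MATHEMATICS ([BorelJacquet1979, §4.1] `G(𝔸) = G_∞ × G(𝔸_f)`; [Mok2014, §1] `U(J_W)(𝔸_f) = U(1)(𝔸_{F,f})` for a line).  Put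
`χ(u_f) := χ̃([(1, u_f · 1_W)])` for `u_f ∈ U(1)(𝔸_{F,f})` (★ `finAdelicCenter`, ★ `finAdelicToAdelic`).  It is a continuous character; it is
trivial on a rational norm-one `x ∈ E¹`: the rational point `γ = x · 1_W ∈ U(J_W a)(F)` (★ `ratCenter`) has finite part `(x)_f · 1_W`
(★ `coe_finAdelicCenterInv_finPart_toAdelic`) and `γ = (γ_∞, 1) · (1, γ_f)` (★ `archToAdelic_mul_finAdelicToAdelic`), so
`[(1, γ_f)] = [(γ_∞, 1)]⁻¹ · [γ] = [(γ_∞⁻¹, 1)]` and `χ̃` is `1` there by archimedean triviality.  Finally `chiQuot a χ [h] = χ_W(h_f) =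
χ̃([(1, h_f)]) = χ̃([(h_∞,1)]) · χ̃([(1,h_f)]) = χ̃([h])`.

* §1 `archToAdelic_eq_adelicCenter_archDet` — on a LINE the archimedean factor is central: `(x_∞, 1) = (det_∞ x_∞, 1) · 1_W`
  (★ `adelicDet`, ★ `relNormOneInfToIdeles_archDet`, `g = det g · 1₁` ★ `coe_eq_det_smul_one`); hence
  `charQuot_archToAdelic_eq_one_of_archUnit` — triviality on the archimedean TORUS `(y, 1) · 1_W`, `y ∈ U(1)(F ⊗ ℝ)` (the form produced by
  ★ `ThetaLiftFromLineCentralCharacter.charCM_archCentre_eq_one_of_holCotForm`) implies triviality on every `(x_∞, 1)`;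
* §2 **`exists_chi_chiQuot_eq`** — the descent (`∀ x_∞`, `χ̃ [(x_∞,1)] = 1`) `⇒ ∃ χ : Chi F E c, chiQuot … a χ = χ̃`;
  **`exists_chi_chiQuot_eq_of_archUnit`** — the same from the torus form of the hypothesis; `chi_unique_of_chiQuot_eq` — uniqueness.

HONEST SCOPE.  Generic over a quadratic `E/F` (`h2 : [E:F] = 2`, `hc : c ≠ 1`) and a line `J_W a`, exactly the variables of ★ `chiQuot`;
nothing about theta series.  HC_CM is proved only modulo the printed citations until rung 0 closes; this file books nothing and discharges
nothing booked (it pays an in-house step of node B).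

## References
* [Liu2021] Y. Liu, Camb. J. Math. 9 (2021), Def. 4.11 (l. 2090), proof of Prop. 4.13 Case 1 (l. 2137 «`χ_∞ = 1`»).
* [BorelJacquet1979] A. Borel, H. Jacquet, PSPM 33.1 (1979), §4.1.
* [Mok2014] C. P. Mok, Mem. AMS 235 (2015), §1 Notation p. 5.
-/

set_option autoImplicit false

noncomputable section

open NumberField IsDedekindDomain
open scoped ComplexConjugate
open Literature.RepresentationTheory.CompactGroups

namespace Literature.NumberTheory.Automorphic.Liu2021.Def411WeilCarriers

open Literature.NumberTheory.Automorphic Literature.NumberTheory.Automorphic.UnitaryGroup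

variable (F E : Type) [Field F] [NumberField F] [Field E] [NumberField E] [Algebra F E] (c : E ≃ₐ[F] E)
  (h2 : Module.finrank F E = 2) (hc : c ≠ 1) (a : Fˣ)

omit [NumberField F] [NumberField E] in
/-- `det (J_W a) ≠ 0` (a `1 × 1` matrix with non-zero entry). [cite: Liu2021, App. D §D.1 Step 1 (l. 5217)] -/
theorem det_JW_ne_zero : (JW F E a).det ≠ 0 := by
  rw [Matrix.det_fin_one]
  exact JW_apply_ne_zero F E a

/-! ## §1 On a line the archimedean factor is central -/

omit [NumberField F] in
/-- **`(det g) · 1_W = g`** in `U(J_W a)(𝔸_F)`: on a hermitian LINE every element is central (★ `coe_eq_det_smul_one`; = ★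
`UnitaryDualPair.adelicCenter_adelicDet_fin_one` of the see-saw lane, re-derived in one line to keep the imports light).
[cite: Mok2014, §1 Notation p. 5] -/
theorem adelicCenter_adelicDet_line (g : UnitaryGroup.adelic F E c 1 (JW F E a)) :
    UnitaryGroup.adelicCenter F E c 1 (JW F E a) (UnitaryGroup.adelicDet F E c 1 (JW F E a) (det_JW_ne_zero F E a) g) = g :=
  Subtype.ext (Units.ext ((UnitaryGroup.coe_adelicCenter F E c 1 (JW F E a) _).trans (UnitaryGroup.coe_eq_det_smul_one E _).symm))

set_option maxHeartbeats 800000 in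
/-- **`(x_∞, 1) = (det_∞ x_∞, 1) · 1_W`** through the archimedean torus `det_∞ x_∞ ∈ U(1)(F ⊗ ℝ)` (★ `archDet`,
★ `relNormOneInfToIdeles_archDet`). [cite: Mok2014, §1 Notation p. 5] [cite: BorelJacquet1979, §4.1] -/
theorem archToAdelic_eq_adelicCenter_archDet (x : UnitaryGroup.arch F E c 1 (JW F E a)) :
    UnitaryGroup.archToAdelic F E c 1 (JW F E a) x =
      UnitaryGroup.adelicCenter F E c 1 (JW F E a)
        ((adelicOneEquivRelNormOne F E c h2 hc).symm
          (relNormOneInfToIdeles F E (UnitaryGroup.archDet F E c 1 (JW F E a) h2 hc (det_JW_ne_zero F E a) x))) := by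
  have h1 : (adelicOneEquivRelNormOne F E c h2 hc).symm
      (relNormOneInfToIdeles F E (UnitaryGroup.archDet F E c 1 (JW F E a) h2 hc (det_JW_ne_zero F E a) x)) =
      UnitaryGroup.adelicDet F E c 1 (JW F E a) (det_JW_ne_zero F E a) (UnitaryGroup.archToAdelic F E c 1 (JW F E a) x) := by
    rw [UnitaryGroup.relNormOneInfToIdeles_archDet, MulEquiv.symm_apply_apply]
  rw [h1, adelicCenter_adelicDet_line]

/-- The finite part of the rational central point `x · 1_W`, `x ∈ E¹`, is `(x)_f · 1_W`. [cite: Mok2014, §1 Notation p. 5] -/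
theorem finPart_toAdelic_ratCenter (x : Eˣ)
    (hx : Units.map (algebraMap E (FiniteAdeleRing (𝓞 E) E)).toMonoidHom x ∈ UnitaryGroup.finAdelicOne F E c) :
    UnitaryGroup.finPart F E c 1 (JW F E a) (UnitaryGroup.toAdelic F E c 1 (JW F E a)
        (UnitaryGroup.ratCenter F E c 1 (JW F E a)
          ⟨x, (UnitaryGroup.mem_ratOne_iff F E c x).2 (apply_mul_self_eq_one_of_mem_finAdelicOne F E c x hx)⟩)) =
      UnitaryGroup.finAdelicCenter F E c 1 (JW F E a) ⟨_, hx⟩ := by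
  set γ := UnitaryGroup.ratCenter F E c 1 (JW F E a)
    ⟨x, (UnitaryGroup.mem_ratOne_iff F E c x).2 (apply_mul_self_eq_one_of_mem_finAdelicOne F E c x hx)⟩ with hγ
  have hdet : Matrix.GeneralLinearGroup.det (γ : GL (Fin 1) E) = x := by
    refine Units.ext ?_
    rw [Matrix.GeneralLinearGroup.val_det_apply, Matrix.det_fin_one, hγ, UnitaryGroup.coe_ratCenter, Matrix.smul_apply,
      Matrix.one_apply_eq, smul_eq_mul, mul_one]
  have hinv : UnitaryGroup.finAdelicCenterInv F E c (JW F E a) (JW_apply_ne_zero F E a)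
      (UnitaryGroup.finPart F E c 1 (JW F E a) (UnitaryGroup.toAdelic F E c 1 (JW F E a) γ)) = ⟨_, hx⟩ := by
    refine Subtype.ext ?_
    rw [coe_finAdelicCenterInv_finPart_toAdelic, hdet]
  rw [← hinv, UnitaryGroup.finAdelicCenter_finAdelicCenterInv]

variable [(UnitaryGroup.toAdelic F E c 1 (JW F E a)).range.Normal]

/-- **Torus form ⇒ factor form of archimedean triviality**: a character of `[U(J_W a)]` which is `1` on the archimedean torus
`[(y, 1) · 1_W]`, `y ∈ U(1)(F ⊗ ℝ)` (the form of ★ `ThetaLiftFromLineCentralCharacter.charCM_archCentre_eq_one_of_holCotForm`), is `1` on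
every archimedean element `[(x_∞, 1)]`. [cite: BorelJacquet1979, §4.1] -/
theorem charQuot_archToAdelic_eq_one_of_archUnit
    (χt : PontryaginDual (UnitaryGroup.adelic F E c 1 (JW F E a) ⧸ (UnitaryGroup.toAdelic F E c 1 (JW F E a)).range))
    (harch : ∀ y : relNormOneInfUnits F E,
      χt (QuotientGroup.mk (UnitaryGroup.adelicCenter F E c 1 (JW F E a)
        ((adelicOneEquivRelNormOne F E c h2 hc).symm (relNormOneInfToIdeles F E y)))) = 1)
    (x : UnitaryGroup.arch F E c 1 (JW F E a)) :
    χt (QuotientGroup.mk (UnitaryGroup.archToAdelic F E c 1 (JW F E a) x)) = 1 := by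
  rw [archToAdelic_eq_adelicCenter_archDet F E c h2 hc a x]
  exact harch _

/-! ## §2 The descent `χ̃ ↦ χ ∈ Chi` -/

/-- **THE DESCENT** [Liu2021, Def. 4.11]: a continuous unitary character `χ̃` of `[U(J_W a)]` which is trivial on every archimedean element
`[(x_∞, 1)]` is `chiQuot a χ` for some `χ ∈ Chi F E c` — namely `χ(u_f) = χ̃([(1, u_f · 1_W)])`, automorphic because a rational
`x ∈ E¹` gives the rational point `x · 1_W` whose class is trivial and whose archimedean part `χ̃` does not see.
[cite: Liu2021, Def. 4.11 (l. 2090); proof of Prop. 4.13 Case 1 (l. 2137)] [cite: BorelJacquet1979, §4.1] -/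
theorem exists_chi_chiQuot_eq
    (χt : PontryaginDual (UnitaryGroup.adelic F E c 1 (JW F E a) ⧸ (UnitaryGroup.toAdelic F E c 1 (JW F E a)).range))
    (harch : ∀ x : UnitaryGroup.arch F E c 1 (JW F E a),
      χt (QuotientGroup.mk (UnitaryGroup.archToAdelic F E c 1 (JW F E a) x)) = 1) :
    ∃ χ : Chi F E c, chiQuot F E c h2 hc a χ = χt := by
  -- `ψ = χ̃ ∘ [·]` as a homomorphism on `U(J_W a)(𝔸_F)` (typed on the datum's `Adelic`, where `archToAdelic`, `finAdelicToAdelic` land)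
  set ψ : (adelicGroupData F E c 1 (JW F E a)).Adelic →* Circle :=
    χt.toMonoidHom.comp (QuotientGroup.mk' (UnitaryGroup.toAdelic F E c 1 (JW F E a)).range) with hψ
  have hψ_apply : ∀ z : (adelicGroupData F E c 1 (JW F E a)).Adelic, ψ z = χt (QuotientGroup.mk z) := fun z => rfl
  have harch' : ∀ y : UnitaryGroup.arch F E c 1 (JW F E a), ψ (UnitaryGroup.archToAdelic F E c 1 (JW F E a) y) = 1 := harch
  have hrange : ∀ γ : UnitaryGroup.rational F E c 1 (JW F E a), ψ (UnitaryGroup.toAdelic F E c 1 (JW F E a) γ) = 1 := by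
    intro γ
    have hmem : (UnitaryGroup.toAdelic F E c 1 (JW F E a) γ) ∈ (UnitaryGroup.toAdelic F E c 1 (JW F E a)).range := ⟨γ, rfl⟩
    rw [hψ_apply, (QuotientGroup.eq_one_iff _).2 hmem, map_one]
  -- the candidate: `u_f ↦ χ̃([(1, u_f · 1_W)])`
  obtain ⟨φ, hφval⟩ : ∃ φ : UnitaryGroup.finAdelicOne F E c →* ℂˣ, ∀ u, ((φ u : ℂˣ) : ℂ) =
      (ψ (UnitaryGroup.finAdelicToAdelic F E c 1 (JW F E a) (UnitaryGroup.finAdelicCenter F E c 1 (JW F E a) u)) : ℂ) :=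
    ⟨Circle.toUnits.comp (ψ.comp
      ((UnitaryGroup.finAdelicToAdelic F E c 1 (JW F E a)).comp (UnitaryGroup.finAdelicCenter F E c 1 (JW F E a)))),
      fun u => rfl⟩
  -- continuity
  have hψc : Continuous ψ := χt.continuous.comp QuotientGroup.continuous_mk
  have hval : Continuous fun u => ((φ u : ℂˣ) : ℂ) := by
    simp only [hφval]
    exact continuous_subtype_val.comp (hψc.comp
      ((UnitaryGroup.continuous_finAdelicToAdelic F E c 1 (JW F E a)).comp
        (UnitaryGroup.continuous_finAdelicCenter F E c 1 (JW F E a))))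
  have hφc : Continuous φ := by
    refine Units.continuous_iff.2 ⟨hval, ?_⟩
    have h : (fun u => (((φ u)⁻¹ : ℂˣ) : ℂ)) = fun u => ((φ u⁻¹ : ℂˣ) : ℂ) := by
      funext u; rw [map_inv]
    rw [h]
    exact hval.comp continuous_inv
  -- automorphy: trivial on the rational norm-one elements
  have hφrat : ∀ (x : Eˣ) (hx : Units.map (algebraMap E (FiniteAdeleRing (𝓞 E) E)).toMonoidHom x ∈ UnitaryGroup.finAdelicOne F E c),
      φ ⟨_, hx⟩ = 1 := by
    intro x hx
    set γ := UnitaryGroup.ratCenter F E c 1 (JW F E a)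
      ⟨x, (UnitaryGroup.mem_ratOne_iff F E c x).2 (apply_mul_self_eq_one_of_mem_finAdelicOne F E c x hx)⟩ with hγ
    set g : (adelicGroupData F E c 1 (JW F E a)).Adelic := UnitaryGroup.toAdelic F E c 1 (JW F E a) γ with hg
    have hfin : UnitaryGroup.finAdelicToAdelic F E c 1 (JW F E a) (UnitaryGroup.finAdelicCenter F E c 1 (JW F E a) ⟨_, hx⟩) =
        UnitaryGroup.finAdelicToAdelic F E c 1 (JW F E a) (UnitaryGroup.finPart F E c 1 (JW F E a) g) := by
      rw [hg, hγ, finPart_toAdelic_ratCenter]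
    -- `(1, g_f) = (g_∞, 1)⁻¹ · g`
    have hdec : UnitaryGroup.finAdelicToAdelic F E c 1 (JW F E a) (UnitaryGroup.finPart F E c 1 (JW F E a) g) =
        (UnitaryGroup.archToAdelic F E c 1 (JW F E a) (UnitaryGroup.archPart F E c 1 (JW F E a) g))⁻¹ * g := by
      rw [eq_inv_mul_iff_mul_eq, UnitaryGroup.archToAdelic_mul_finAdelicToAdelic]
    apply Units.ext
    rw [hφval, hfin, hdec, map_mul, map_inv, harch', inv_one, one_mul, hg, hrange, Units.val_one, Circle.coe_one]
  refine ⟨⟨φ, hφc, hφrat⟩, ?_⟩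
  -- `chiQuot a χ = χ̃`: compare on `[h]`, `h = (h_∞, 1) · (1, h_f)`
  apply ContinuousMonoidHom.ext
  intro q
  obtain ⟨h, rfl⟩ := QuotientGroup.mk_surjective q
  apply Circle.ext
  show ((lineChar F E c a φ (UnitaryGroup.finPart F E c 1 (JW F E a) h) : ℂˣ) : ℂ) = (ψ h : ℂ)
  rw [lineChar_eq_apply_finAdelicCenterInv, hφval, UnitaryGroup.finAdelicCenter_finAdelicCenterInv]
  conv_rhs => rw [← UnitaryGroup.archToAdelic_mul_finAdelicToAdelic F E c 1 (JW F E a) h, map_mul, harch', one_mul]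

/-- **THE DESCENT, torus form**: if `χ̃` is `1` on the archimedean torus `[(y,1) · 1_W]` (`y ∈ U(1)(F ⊗ ℝ)`), then `χ̃ = chiQuot a χ` for some
`χ ∈ Chi F E c`. [cite: Liu2021, Def. 4.11 (l. 2090); proof of Prop. 4.13 Case 1 (l. 2137)] -/
theorem exists_chi_chiQuot_eq_of_archUnit
    (χt : PontryaginDual (UnitaryGroup.adelic F E c 1 (JW F E a) ⧸ (UnitaryGroup.toAdelic F E c 1 (JW F E a)).range))
    (harch : ∀ y : relNormOneInfUnits F E,
      χt (QuotientGroup.mk (UnitaryGroup.adelicCenter F E c 1 (JW F E a)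
        ((adelicOneEquivRelNormOne F E c h2 hc).symm (relNormOneInfToIdeles F E y)))) = 1) :
    ∃ χ : Chi F E c, chiQuot F E c h2 hc a χ = χt :=
  exists_chi_chiQuot_eq F E c h2 hc a χt (charQuot_archToAdelic_eq_one_of_archUnit F E c h2 hc a χt harch)

/-- **Uniqueness of the descent**: `chiQuot` is injective on `Chi` (`χ(u_f) = chiQuot a χ [(1, u_f · 1_W)]`).
[cite: Liu2021, Def. 4.11 (l. 2090)] -/
theorem chi_unique_of_chiQuot_eq {χ χ' : Chi F E c} (h : chiQuot F E c h2 hc a χ = chiQuot F E c h2 hc a χ') : χ = χ' := by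
  apply Subtype.ext
  apply MonoidHom.ext
  intro u
  apply Units.ext
  have hu := congrArg
    (fun ψ : PontryaginDual (UnitaryGroup.adelic F E c 1 (JW F E a) ⧸ (UnitaryGroup.toAdelic F E c 1 (JW F E a)).range) =>
      ((ψ (QuotientGroup.mk (UnitaryGroup.finAdelicToAdelic F E c 1 (JW F E a)
        (UnitaryGroup.finAdelicCenter F E c 1 (JW F E a) u))) : Circle) : ℂ)) h
  rwa [coe_chiQuot_mk_finAdelicToAdelic, coe_chiQuot_mk_finAdelicToAdelic, lineChar_eq_apply_finAdelicCenterInv,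
    lineChar_eq_apply_finAdelicCenterInv, UnitaryGroup.finAdelicCenterInv_finAdelicCenter] at hu

end Literature.NumberTheory.Automorphic.Liu2021.Def411WeilCarriers

end
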